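import Summits.ABC.ABC.Theorems.TowerFourSubLiouville.Negative.HallLangTransferTrident
import Summits.ABC.ABC.Theorems.TowerFourSubLiouville.Negative.TwoExponentDiagram

/-!
# `TowerFourSubLiouville` (stmt-ABC-1649): the dictionary-restricted core is PINNED at `κ = 5/4` by a
# Pell-boosted trident family; a first TORUS corner `(8/3, 0)` of the two-exponent diagram

Negative-side calibration (standing disprover, cycle 10, refuter-cdisprove-stmt-ABC-1649-g10-0, 2026-08-17) for the picked
line `SketchIdeator5` (card `cm-hall-lang-transfer`, lead a1; dead at its core `stub_hallLang1728`, which `ABC` implies).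
`Negative.HallLangTransferTrident` (p132837) restricted the core `HallLang1728 κ` to the only points the composition feeds
it — the dictionary images `(x, N) = (v w Y², a v w²)` of coprime solutions of `w Z⁴ = v Y⁴ + a` — and showed this
`TridentHallLang κ` FALSE for every `κ < 6/5` by a POLYNOMIAL family, leaving the window `[6/5, 5/4)` below the
random-model = `ABC` threshold `5/4` open ("polynomial families are capped below `5/4`: `deg Y ≤ (deg Z − 1)/3`").
This file closes the window with an EXPONENTIAL (Pell-boosted) family, exactly as `Negative.HallLangTransferPell`
(p132424) closed `[3/2, 2)` for the unrestricted core: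

  **`u² + 1 = 2t²  ⟹  (u (t² + 1))² + 1 = t⁴ · (2t² + 3)`**            (`tridentPell_identity`)

(the Hensel lift of the square root `u` of `−1` modulo `t²` on the conic `u² + 1 = 2t²` is `u(1 + t²)` modulo `t⁴`,
and it has degree `3 = 3 · deg t` — Mason–Stothers on the torus allows `deg Y = deg Z / 3` ON THE NOSE, while on `ℙ¹`
only `deg Y ≤ (deg Z − 1)/3`).  Along the negative Pell sequence `(u, t) = (1,1), (7,5), (41,29), (239,169), (1393,985), …`
(`negPell_exists`: `(u,t) ↦ (3u + 4t, 2u + 3t)`) put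

  `Z = u(t² + 1)`,  `Y = t`,  `c = 2t² + 3`,  `Z² + 1 = Y⁴ c`,  `w = a = 1`,  `v = c (Z − 1)(Z + 1)`:  `Z⁴ = v Y⁴ + 1`

(`trident_equation`; worked member `182² + 1 = 5⁴ · 53`).  Sizes: `t³ ≤ Z ≤ 4t³`, `v ≤ 100 t⁸` (indeed
`v + 4t² + 6 = t⁴ c²`, `v ∼ 4t⁸`, `Z ∼ √2 t³`), coprimality automatic (`trident_coprime`, p132837).  Consequences:

* `not_tridentHallLang_of_lt_five_fourths`: the dictionary-restricted core is FALSE for every `κ < 5/4`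
  (`x = vY² = v t² ∼ 4t¹⁰` against `N = v ∼ 4t⁸`; Hall–Lang ratio `log x / log N → 5/4`);
  `tridentHallLang_exponent_ge_five_fourths`: any witness `(κ, C)` has `κ ≥ 5/4`;
* `not_tridentHallLang_five_fourths_of_sq_lt_half`: AT `κ = 5/4` the constant must satisfy `2C² ≥ 1`, i.e.
  `C ≥ 2^{−1/2}` (`x / N^{5/4} = t²/v^{1/4} ↗ 2^{−1/2}` along the family);
* `not_ubq₂_corner_eightThirds_zero`: in the two-exponent diagram of the UNIFORM core (`Negative.TwoExponentDiagram`: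
  coefficients `≤ Z^θ ⟹ |wZ⁴ − vY⁴| > Z^φ`) the corner `(3, 0)` of `bezoutFamily₃` (value exactly `1` at CUBIC coefficient
  height) improves to `(8/3, 0)`: value exactly `1` at coefficient height `≤ 100 Z^{8/3}` — the first corner supplied by a
  TORUS identity, and it lies ON the torus Mason–Stothers line `(3/4)θ_v + (1/4)θ_w + φ = 2` of
  `Negative.TorusEnemyFloor` (`θ_v = 8/3`, `θ_w = φ = 0`), which for `w = 1` is also the random-model boundary
  (`#{Z ≤ X : Y⁴ ∣ Z⁴ − a, Y ≥ Z^{1−θ/4}} ≍ Σ_Z Z^{3θ/4 + φ − 3}`).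

So the restricted dial now reads `[5/4 PROVED floor = random-model threshold = ABC ceiling]`: PINNED, like the
unrestricted one (`κ = 2`, p132424) and the crux-fibre one (`K = 1/2`, p131711).  For the line: restricting the core to
dictionary points buys `TridentHallLang κ ⟹ UBQ η` only for `η < 4/(8κ + 1) ≤ 4/11`, and the restricted core too would
have to be proved AT its conjectural exponent.  No statement here is a Theses decl; nothing positive about the crux is
asserted (`ABC ⟹ crux`, `Negative.Framing`, p74157: no refutation exists short of `¬ABC`).
-/

-- `Summit.ABC.ABC` is the mandated summit-side namespace (CONVENTIONS §2); the duplicate is deliberate.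
set_option linter.dupNamespace false

namespace Summit.ABC.ABC.Theorems.TowerFourSubLiouville.Negative

/-! ## The negative Pell sequence `u² + 1 = 2t²` -/

/-- One step of the Pell recursion `(u, t) ↦ (3u + 4t, 2u + 3t)` on `u² + 1 = 2t²`. -/
theorem negPell_step {u t : ℕ} (h : u ^ 2 + 1 = 2 * t ^ 2) :
    (3 * u + 4 * t) ^ 2 + 1 = 2 * (2 * u + 3 * t) ^ 2 := by
  zify at h ⊢
  linear_combination h

/-- Arbitrarily large solutions of `u² + 1 = 2t²` with `t ≤ u` and `t ≥ n + 1`. -/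
theorem negPell_exists (n : ℕ) : ∃ u t : ℕ, u ^ 2 + 1 = 2 * t ^ 2 ∧ t ≤ u ∧ n + 1 ≤ t := by
  induction n with
  | zero => exact ⟨1, 1, by norm_num, le_rfl, le_rfl⟩
  | succ n ih =>
    obtain ⟨u, t, h, htu, ht⟩ := ih
    exact ⟨3 * u + 4 * t, 2 * u + 3 * t, negPell_step h, by omega, by omega⟩

/-- A solution of `u² + 1 = 2t²` with `t ≤ u`, `1 ≤ t` and `t` beyond any real threshold. -/
theorem negPell_exists_ge (M : ℝ) : ∃ u t : ℕ, u ^ 2 + 1 = 2 * t ^ 2 ∧ t ≤ u ∧ 1 ≤ t ∧ M ≤ (t : ℝ) := by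
  obtain ⟨n, hn⟩ := exists_nat_ge M
  obtain ⟨u, t, h, htu, ht⟩ := negPell_exists n
  exact ⟨u, t, h, htu, by omega, le_trans hn (by exact_mod_cast (by omega : n ≤ t))⟩

/-- On `u² + 1 = 2t²`: `u ≤ 2t`. -/
theorem negPell_u_le {u t : ℕ} (h : u ^ 2 + 1 = 2 * t ^ 2) : u ≤ 2 * t := by
  nlinarith [h]

/-! ## The Pell-boosted trident identity -/

/-- **The Pell-boosted trident identity**: `u² + 1 = 2t² ⟹ (u(t² + 1))² + 1 = t⁴ (2t² + 3)`. -/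
theorem tridentPell_identity {u t : ℕ} (h : u ^ 2 + 1 = 2 * t ^ 2) :
    (u * (t ^ 2 + 1)) ^ 2 + 1 = t ^ 4 * (2 * t ^ 2 + 3) := by
  zify at h ⊢
  linear_combination ((t : ℤ) ^ 2 + 1) ^ 2 * h

/-- Worked members `(u, t) = (7, 5)` and `(41, 29)`: `182² + 1 = 5⁴ · 53`, `34522² + 1 = 29⁴ · 1685`. -/
example : (7 : ℕ) ^ 2 + 1 = 2 * 5 ^ 2 ∧ (7 * (5 ^ 2 + 1) : ℕ) = 182 ∧ (182 : ℕ) ^ 2 + 1 = 5 ^ 4 * 53 ∧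
    (41 : ℕ) ^ 2 + 1 = 2 * 29 ^ 2 ∧ (41 * (29 ^ 2 + 1) : ℕ) = 34522 ∧ (34522 : ℕ) ^ 2 + 1 = 29 ^ 4 * 1685 := by
  norm_num

/-- From `Z² + 1 = Y⁴ c` and `Z = Zm + 1`: the quartic equation `1 · Z⁴ = (c · Zm · (Z + 1)) · Y⁴ + 1`
(`w = a = 1`, `v = c (Z − 1)(Z + 1)`), in the verbatim shape of the trident matrix. -/
theorem trident_equation {Z Y c Zm : ℕ} (h : Z ^ 2 + 1 = Y ^ 4 * c) (hZ : Z = Zm + 1) :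
    1 * Z ^ 4 = (c * Zm * (Z + 1)) * Y ^ 4 + 1 := by
  subst hZ
  zify at h ⊢
  linear_combination ((Zm : ℤ) * ((Zm : ℤ) + 2)) * h

/-! ## Sizes along the family (`u² + 1 = 2t²`, `t ≤ u`, `1 ≤ t`) -/

/-- `t³ ≤ Z = u(t² + 1)`. -/
theorem tridentPell_Z_ge {u t : ℕ} (htu : t ≤ u) : t ^ 3 ≤ u * (t ^ 2 + 1) := by
  calc t ^ 3 = t * t ^ 2 := by ring
    _ ≤ u * (t ^ 2 + 1) := Nat.mul_le_mul htu (Nat.le_succ _)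

/-- `Z = u(t² + 1) ≤ 4t³`. -/
theorem tridentPell_Z_le {u t : ℕ} (h : u ^ 2 + 1 = 2 * t ^ 2) (ht : 1 ≤ t) : u * (t ^ 2 + 1) ≤ 4 * t ^ 3 := by
  have h1 : 1 ≤ t ^ 2 := Nat.one_le_pow _ _ ht
  calc u * (t ^ 2 + 1) ≤ (2 * t) * (2 * t ^ 2) := Nat.mul_le_mul (negPell_u_le h) (by omega)
    _ = 4 * t ^ 3 := by ring

/-- `v = c (Z − 1)(Z + 1) ≤ 100 t⁸`. -/
theorem tridentPell_v_le {u t Zm : ℕ} (h : u ^ 2 + 1 = 2 * t ^ 2) (ht : 1 ≤ t) (hZ : u * (t ^ 2 + 1) = Zm + 1) :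
    (2 * t ^ 2 + 3) * Zm * (u * (t ^ 2 + 1) + 1) ≤ 100 * t ^ 8 := by
  have hZle := tridentPell_Z_le h ht
  have h3 : 1 ≤ t ^ 3 := Nat.one_le_pow _ _ ht
  have h2 : 1 ≤ t ^ 2 := Nat.one_le_pow _ _ ht
  have hZm : Zm ≤ 4 * t ^ 3 := by omega
  have hZp : u * (t ^ 2 + 1) + 1 ≤ 5 * t ^ 3 := by omega
  have hc : 2 * t ^ 2 + 3 ≤ 5 * t ^ 2 := by omega
  calc (2 * t ^ 2 + 3) * Zm * (u * (t ^ 2 + 1) + 1) ≤ (5 * t ^ 2) * (4 * t ^ 3) * (5 * t ^ 3) :=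
        Nat.mul_le_mul (Nat.mul_le_mul hc hZm) hZp
    _ = 100 * t ^ 8 := by ring

/-- The exact size of `v`: `v + 4t² + 6 = t⁴ c²` (`v = c(Z² − 1)`, `Z² + 1 = t⁴ c`), hence `v ≤ t⁴ (2t² + 3)²`. -/
theorem tridentPell_v_le_sharp {u t Zm : ℕ} (h : u ^ 2 + 1 = 2 * t ^ 2) (hZ : u * (t ^ 2 + 1) = Zm + 1) :
    (2 * t ^ 2 + 3) * Zm * (u * (t ^ 2 + 1) + 1) ≤ t ^ 4 * (2 * t ^ 2 + 3) ^ 2 := by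
  have hid := tridentPell_identity h
  rw [hZ] at hid ⊢
  have : (2 * t ^ 2 + 3) * Zm * (Zm + 1 + 1) + (4 * t ^ 2 + 6) = t ^ 4 * (2 * t ^ 2 + 3) ^ 2 := by
    zify at hid ⊢
    linear_combination (2 * (t : ℤ) ^ 2 + 3) * hid
  omega

/-- Real-exponent bookkeeping: `(t⁸)^{s/4} = (t²)^s` for `t ≥ 0`. -/
theorem rpow_eight_fourth {t : ℝ} (ht : 0 ≤ t) (s : ℝ) : (t ^ 8) ^ (s / 4) = (t ^ 2) ^ s := by
  rw [← Real.rpow_natCast t 8, ← Real.rpow_mul ht, ← Real.rpow_natCast t 2, ← Real.rpow_mul ht]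
  congr 1
  push_cast
  ring

/-- The family packaged: beyond every real threshold a member `(t, Z, Zm)` with all the bookkeeping. -/
theorem exists_tridentPell (M : ℝ) : ∃ t Z Zm : ℕ, 1 ≤ t ∧ M ≤ (t : ℝ) ∧ Z = Zm + 1 ∧ 0 < Zm ∧
    Z ^ 2 + 1 = t ^ 4 * (2 * t ^ 2 + 3) ∧ t ^ 3 ≤ Z ∧
    (2 * t ^ 2 + 3) * Zm * (Z + 1) ≤ 100 * t ^ 8 ∧
    (2 * t ^ 2 + 3) * Zm * (Z + 1) ≤ t ^ 4 * (2 * t ^ 2 + 3) ^ 2 := by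
  obtain ⟨u, t, h, htu, ht1, htM⟩ := negPell_exists_ge M
  have hZ2 : 2 ≤ u * (t ^ 2 + 1) := by
    have h1 : 1 ≤ t ^ 2 := Nat.one_le_pow _ _ ht1
    calc 2 = 1 * (1 + 1) := by norm_num
      _ ≤ u * (t ^ 2 + 1) := Nat.mul_le_mul (le_trans ht1 htu) (by omega)
  refine ⟨t, u * (t ^ 2 + 1), u * (t ^ 2 + 1) - 1, ht1, htM, by omega, by omega, tridentPell_identity h,
    tridentPell_Z_ge htu, tridentPell_v_le h ht1 (by omega), tridentPell_v_le_sharp h (by omega)⟩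

/-! ## The dictionary-restricted core needs `κ ≥ 5/4` -/

/-- **The dictionary-restricted core fails for every `κ < 5/4`** (matrix verbatim as in
`not_tridentHallLang_of_lt_six_fifths`, p132837): `x = v w Y²`, `N = a v w²` are the coordinates of the integral point
`SketchIdeator5.integralPoint_of_violator` / `SketchIdeator4.trident_A` of a coprime solution of `w Z⁴ = v Y⁴ + a`. -/
theorem not_tridentHallLang_of_lt_five_fourths (κ : ℝ) (hκ : κ < 5 / 4) :
    ¬ ∃ C : ℝ, 0 < C ∧ ∀ a v w Y Z : ℕ, 0 < a → 0 < v → 0 < w → 0 < Y → 0 < Z →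
        Nat.Coprime (v * Y) (w * Z) → w * Z ^ 4 = v * Y ^ 4 + a →
        ((v * w * Y ^ 2 : ℕ) : ℝ) ≤ C * ((a * v * w ^ 2 : ℕ) : ℝ) ^ κ := by
  rintro ⟨C, hC, h⟩
  -- exponent bookkeeping: `s := max (4(κ-1)) 0 ∈ [0, 1)`
  set s : ℝ := max (4 * (κ - 1)) 0 with hsdef
  have hs0 : 0 ≤ s := le_max_right _ _
  have hs1 : s < 1 := max_lt (by linarith) (by norm_num)
  have hκs : κ - 1 ≤ s / 4 := by
    have : 4 * (κ - 1) ≤ s := le_max_left _ _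
    linarith
  obtain ⟨M, -, hM⟩ := key_growth (K := 2 * C * (100 : ℝ) ^ (s / 4)) (by positivity) hs1
  -- a member of the family with `t² ≥ t ≥ M`
  obtain ⟨t, Z, Zm, ht1, htM, hZZm, hZm0, hid, -, hv100, -⟩ := exists_tridentPell (max M 1)
  have ht1R : (1 : ℝ) ≤ (t : ℝ) := by exact_mod_cast ht1
  have ht0R : (0 : ℝ) ≤ (t : ℝ) := by linarith
  have hTM : M ≤ (t : ℝ) ^ 2 := by
    calc M ≤ (t : ℝ) := le_trans (le_max_left _ _) htM
      _ ≤ (t : ℝ) ^ 2 := by simpa using pow_le_pow_right₀ ht1R (show 1 ≤ 2 by norm_num)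
  set c : ℕ := 2 * t ^ 2 + 3 with hcdef
  have heq : 1 * Z ^ 4 = (c * Zm * (Z + 1)) * t ^ 4 + 1 := trident_equation hid hZZm
  have hcop : Nat.Coprime (c * Zm * (Z + 1) * t) (1 * Z) := trident_coprime hid hZZm
  have hvpos : 0 < c * Zm * (Z + 1) := by positivity
  have htpos : 0 < t := ht1
  have hZpos : 0 < Z := by omega
  have key := h 1 (c * Zm * (Z + 1)) 1 t Z one_pos hvpos one_pos htpos hZpos hcop heq
  -- rewrite the two sides: `x = v t²`, `N = v`
  have hx : (((c * Zm * (Z + 1)) * 1 * t ^ 2 : ℕ) : ℝ) = ((c * Zm * (Z + 1) : ℕ) : ℝ) * ((t : ℕ) : ℝ) ^ 2 := by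
    push_cast; ring
  have hN : ((1 * (c * Zm * (Z + 1)) * 1 ^ 2 : ℕ) : ℝ) = ((c * Zm * (Z + 1) : ℕ) : ℝ) := by push_cast; ring
  rw [hx, hN] at key
  set v : ℝ := ((c * Zm * (Z + 1) : ℕ) : ℝ) with hvdef
  have hv0 : 0 < v := by rw [hvdef]; exact_mod_cast hvpos
  have hv1 : 1 ≤ v := by rw [hvdef]; exact_mod_cast hvpos
  have hvV : v ≤ 100 * ((t : ℕ) : ℝ) ^ 8 := by rw [hvdef]; exact_mod_cast hv100
  -- from `v t² ≤ C v^κ` get `t² ≤ C v^{κ-1} ≤ C v^{s/4} ≤ C 100^{s/4} (t²)^s ≤ t²/2 < t²`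
  have h1 : ((t : ℕ) : ℝ) ^ 2 ≤ C * v ^ (κ - 1) := by
    rw [Real.rpow_sub_one hv0.ne', mul_div_assoc', le_div_iff₀ hv0]
    linarith [key]
  have h2 : v ^ (κ - 1) ≤ v ^ (s / 4) := Real.rpow_le_rpow_of_exponent_le hv1 hκs
  have h3 : v ^ (s / 4) ≤ (100 * ((t : ℕ) : ℝ) ^ 8) ^ (s / 4) := Real.rpow_le_rpow hv0.le hvV (by positivity)
  have h4 : (100 * ((t : ℕ) : ℝ) ^ 8) ^ (s / 4) = (100 : ℝ) ^ (s / 4) * (((t : ℕ) : ℝ) ^ 2) ^ s := by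
    rw [Real.mul_rpow (by positivity) (by positivity), rpow_eight_fourth ht0R]
  have h5 := hM (((t : ℕ) : ℝ) ^ 2) hTM
  have : ((t : ℕ) : ℝ) ^ 2 < ((t : ℕ) : ℝ) ^ 2 :=
    calc ((t : ℕ) : ℝ) ^ 2 ≤ C * v ^ (κ - 1) := h1
      _ ≤ C * v ^ (s / 4) := mul_le_mul_of_nonneg_left h2 hC.le
      _ ≤ C * (100 * ((t : ℕ) : ℝ) ^ 8) ^ (s / 4) := mul_le_mul_of_nonneg_left h3 hC.le
      _ = (2 * C * (100 : ℝ) ^ (s / 4) * (((t : ℕ) : ℝ) ^ 2) ^ s) / 2 := by rw [h4]; ring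
      _ ≤ ((t : ℕ) : ℝ) ^ 2 / 2 := by linarith
      _ < ((t : ℕ) : ℝ) ^ 2 := by linarith [show (0 : ℝ) < ((t : ℕ) : ℝ) ^ 2 from by positivity]
  exact lt_irrefl _ this

/-- … hence any witness `(κ, C)` of the dictionary-restricted core has `κ ≥ 5/4` (supersedes `≥ 6/5`, p132837). -/
theorem tridentHallLang_exponent_ge_five_fourths (κ C : ℝ) (hC : 0 < C)
    (h : ∀ a v w Y Z : ℕ, 0 < a → 0 < v → 0 < w → 0 < Y → 0 < Z →
        Nat.Coprime (v * Y) (w * Z) → w * Z ^ 4 = v * Y ^ 4 + a →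
        ((v * w * Y ^ 2 : ℕ) : ℝ) ≤ C * ((a * v * w ^ 2 : ℕ) : ℝ) ^ κ) : 5 / 4 ≤ κ := by
  by_contra hκ
  exact not_tridentHallLang_of_lt_five_fourths κ (not_le.mp hκ) ⟨C, hC, h⟩

/-- **At the threshold `κ = 5/4` the constant must satisfy `2C² ≥ 1`** (`C ≥ 2^{-1/2} ≈ 0.7071`): along the family
`x / N^{5/4} = t² / v^{1/4}` increases to `2^{-1/2}` (`v + 4t² + 6 = t⁴(2t² + 3)²`). -/
theorem not_tridentHallLang_five_fourths_of_sq_lt_half (C : ℝ) (hC2 : 2 * C ^ 2 < 1) :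
    ¬ ∀ a v w Y Z : ℕ, 0 < a → 0 < v → 0 < w → 0 < Y → 0 < Z →
        Nat.Coprime (v * Y) (w * Z) → w * Z ^ 4 = v * Y ^ 4 + a →
        ((v * w * Y ^ 2 : ℕ) : ℝ) ≤ C * ((a * v * w ^ 2 : ℕ) : ℝ) ^ (5 / 4 : ℝ) := by
  intro h
  -- a member with `t > 3C²/(1 - 2C²)`
  have hden : 0 < 1 - 2 * C ^ 2 := by linarith
  obtain ⟨t, Z, Zm, ht1, htM, hZZm, hZm0, hid, -, -, hvsharp⟩ :=
    exists_tridentPell (3 * C ^ 2 / (1 - 2 * C ^ 2) + 1)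
  have ht1R : (1 : ℝ) ≤ (t : ℝ) := by exact_mod_cast ht1
  set c : ℕ := 2 * t ^ 2 + 3 with hcdef
  have heq : 1 * Z ^ 4 = (c * Zm * (Z + 1)) * t ^ 4 + 1 := trident_equation hid hZZm
  have hcop : Nat.Coprime (c * Zm * (Z + 1) * t) (1 * Z) := trident_coprime hid hZZm
  have hvpos : 0 < c * Zm * (Z + 1) := by positivity
  have htpos : 0 < t := ht1
  have hZpos : 0 < Z := by omega
  have key := h 1 (c * Zm * (Z + 1)) 1 t Z one_pos hvpos one_pos htpos hZpos hcop heq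
  have hx : (((c * Zm * (Z + 1)) * 1 * t ^ 2 : ℕ) : ℝ) = ((c * Zm * (Z + 1) : ℕ) : ℝ) * ((t : ℕ) : ℝ) ^ 2 := by
    push_cast; ring
  have hN : ((1 * (c * Zm * (Z + 1)) * 1 ^ 2 : ℕ) : ℝ) = ((c * Zm * (Z + 1) : ℕ) : ℝ) := by push_cast; ring
  rw [hx, hN] at key
  set v : ℝ := ((c * Zm * (Z + 1) : ℕ) : ℝ) with hvdef
  have hv0 : 0 < v := by rw [hvdef]; exact_mod_cast hvpos
  have hvS : v ≤ ((t : ℕ) : ℝ) ^ 4 * (2 * ((t : ℕ) : ℝ) ^ 2 + 3) ^ 2 := by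
    rw [hvdef]; exact_mod_cast hvsharp
  -- `C > 0` (else `v t² ≤ C v^{5/4} ≤ 0`)
  have hvr0 : 0 < v ^ (5 / 4 : ℝ) := Real.rpow_pos_of_pos hv0 _
  have hCpos : 0 < C := by
    by_contra hC
    have hC' : C ≤ 0 := not_lt.mp hC
    have h0 : C * v ^ (5 / 4 : ℝ) ≤ 0 := mul_nonpos_of_nonpos_of_nonneg hC' hvr0.le
    have h1 : 0 < v * ((t : ℕ) : ℝ) ^ 2 := by positivity
    linarith
  -- the fourth root `r = v^{1/4}`: `r⁴ = v`, `v^{5/4} = v · r`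
  set r : ℝ := v ^ (1 / 4 : ℝ) with hrdef
  have hr0 : 0 < r := Real.rpow_pos_of_pos hv0 _
  have hr4 : r ^ 4 = v := by
    rw [hrdef, ← Real.rpow_natCast, ← Real.rpow_mul hv0.le]
    norm_num
  have hr5 : v ^ (5 / 4 : ℝ) = v * r := by
    rw [hrdef, ← Real.rpow_one_add' hv0.le (by norm_num)]
    norm_num
  rw [hr5] at key
  -- `t² ≤ C r`, hence `t⁸ ≤ C⁴ v ≤ C⁴ t⁴ c²`, hence `t² ≤ C² c = C² (2t² + 3)`
  have h1 : ((t : ℕ) : ℝ) ^ 2 ≤ C * r := by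
    have : v * ((t : ℕ) : ℝ) ^ 2 ≤ v * (C * r) := by linarith [key]
    exact le_of_mul_le_mul_left this hv0
  have h2 : (((t : ℕ) : ℝ) ^ 2) ^ 4 ≤ (C * r) ^ 4 := pow_le_pow_left₀ (by positivity) h1 4
  have h3 : (C * r) ^ 4 = C ^ 4 * v := by rw [mul_pow, hr4]
  have h4 : (((t : ℕ) : ℝ) ^ 2) ^ 4 ≤ C ^ 4 * (((t : ℕ) : ℝ) ^ 4 * (2 * ((t : ℕ) : ℝ) ^ 2 + 3) ^ 2) := by
    calc (((t : ℕ) : ℝ) ^ 2) ^ 4 ≤ (C * r) ^ 4 := h2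
      _ = C ^ 4 * v := h3
      _ ≤ C ^ 4 * (((t : ℕ) : ℝ) ^ 4 * (2 * ((t : ℕ) : ℝ) ^ 2 + 3) ^ 2) :=
          mul_le_mul_of_nonneg_left hvS (by positivity)
  have ht2pos : (0 : ℝ) < ((t : ℕ) : ℝ) ^ 2 := by positivity
  -- divide by `t⁴ > 0`: `(t²)² ≤ (C² (2t²+3))²`
  have h5 : (((t : ℕ) : ℝ) ^ 2) ^ 2 ≤ (C ^ 2 * (2 * ((t : ℕ) : ℝ) ^ 2 + 3)) ^ 2 := by
    have ht4 : (0 : ℝ) < ((t : ℕ) : ℝ) ^ 4 := by positivity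
    have : (((t : ℕ) : ℝ) ^ 2) ^ 2 * ((t : ℕ) : ℝ) ^ 4 ≤ (C ^ 2 * (2 * ((t : ℕ) : ℝ) ^ 2 + 3)) ^ 2 * ((t : ℕ) : ℝ) ^ 4 := by
      nlinarith [h4]
    exact le_of_mul_le_mul_right this ht4
  have h6 : ((t : ℕ) : ℝ) ^ 2 ≤ C ^ 2 * (2 * ((t : ℕ) : ℝ) ^ 2 + 3) :=
    (pow_le_pow_iff_left₀ (by positivity) (by positivity) two_ne_zero).mp h5
  -- `t² (1 - 2C²) ≤ 3C²`, contradicting `t² ≥ t > 3C²/(1 - 2C²)`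
  have h7 : ((t : ℕ) : ℝ) ^ 2 * (1 - 2 * C ^ 2) ≤ 3 * C ^ 2 := by nlinarith [h6]
  have h8 : ((t : ℕ) : ℝ) ^ 2 ≤ 3 * C ^ 2 / (1 - 2 * C ^ 2) := by
    rw [le_div_iff₀ hden]; exact h7
  have h9 : ((t : ℕ) : ℝ) ≤ ((t : ℕ) : ℝ) ^ 2 := by
    simpa using pow_le_pow_right₀ ht1R (show 1 ≤ 2 by norm_num)
  have h10 : (3 * C ^ 2 / (1 - 2 * C ^ 2) + 1 : ℝ) ≤ ((t : ℕ) : ℝ) := by exact_mod_cast htM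
  linarith

/-! ## A torus corner of the two-exponent diagram: `(8/3, 0)` -/

/-- **Corner `(8/3, 0)`: `UBQ₂(θ, φ)` fails for `θ > 8/3` and EVERY `φ ≥ 0`** — the value `wZ⁴ − vY⁴` is exactly `1` at
coefficient height `max(v, w) = v ≤ 100 Z^{8/3}` along the Pell-boosted trident family (improves the cubic-height corner
`(3, 0)` of `not_ubq₂_corner_three_zero`; matrix verbatim as there). -/
theorem not_ubq₂_corner_eightThirds_zero (θ φ : ℝ) (hθ : 8 / 3 < θ) (hφ : 0 ≤ φ) :
    ¬ ∃ Z₀ : ℕ, ∀ v w Y Z : ℕ, Z₀ ≤ Z → 0 < v → 0 < w → 0 < Y → Nat.Coprime (v * Y) (w * Z) →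
      ((max v w : ℕ) : ℝ) ≤ (Z : ℝ) ^ θ → w * Z ^ 4 ≠ v * Y ^ 4 →
      (Z : ℝ) ^ φ < |((w * Z ^ 4 : ℕ) : ℝ) - ((v * Y ^ 4 : ℕ) : ℝ)| := by
  rintro ⟨Z₀, h⟩
  obtain ⟨N₁, hN₁⟩ := eventually_const_mul_rpow_le 100 (8 / 3) θ hθ
  obtain ⟨t, Z, Zm, ht1, htM, hZZm, hZm0, hid, htZ, hv100, -⟩ := exists_tridentPell ((max Z₀ N₁ : ℕ) : ℝ)
  set c : ℕ := 2 * t ^ 2 + 3 with hcdef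
  have heq : 1 * Z ^ 4 = (c * Zm * (Z + 1)) * t ^ 4 + 1 := trident_equation hid hZZm
  have hcop : Nat.Coprime (c * Zm * (Z + 1) * t) (1 * Z) := trident_coprime hid hZZm
  have hvpos : 0 < c * Zm * (Z + 1) := by positivity
  have htpos : 0 < t := ht1
  -- `Z ≥ t³ ≥ t ≥ max Z₀ N₁`
  have htZ' : t ≤ Z := le_trans (by simpa using Nat.pow_le_pow_right ht1 (show 1 ≤ 3 by norm_num)) htZ
  have htmax : max Z₀ N₁ ≤ t := by exact_mod_cast htM
  have hZ₀ : Z₀ ≤ Z := le_trans (le_trans (le_max_left _ _) htmax) htZ'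
  have hN₁Z : N₁ ≤ Z := le_trans (le_trans (le_max_right _ _) htmax) htZ'
  -- coefficient height: `v ≤ 100 t⁸ ≤ 100 Z^{8/3} ≤ Z^θ`
  have ht0R : (0 : ℝ) ≤ ((t : ℕ) : ℝ) := by positivity
  have h8 : ((t : ℕ) : ℝ) ^ 8 ≤ ((Z : ℕ) : ℝ) ^ (8 / 3 : ℝ) := by
    have h3 : ((t : ℕ) : ℝ) ^ 3 ≤ ((Z : ℕ) : ℝ) := by exact_mod_cast htZ
    have e : ((t : ℕ) : ℝ) ^ 8 = (((t : ℕ) : ℝ) ^ 3) ^ (8 / 3 : ℝ) := by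
      rw [← Real.rpow_natCast ((t : ℕ) : ℝ) 3, ← Real.rpow_mul ht0R, ← Real.rpow_natCast ((t : ℕ) : ℝ) 8]
      norm_num
    rw [e]
    exact Real.rpow_le_rpow (by positivity) h3 (by norm_num)
  have hmax : ((max (c * Zm * (Z + 1)) 1 : ℕ) : ℝ) ≤ ((Z : ℕ) : ℝ) ^ θ := by
    rw [max_eq_left (Nat.one_le_iff_ne_zero.mpr hvpos.ne')]
    have hv : ((c * Zm * (Z + 1) : ℕ) : ℝ) ≤ 100 * ((t : ℕ) : ℝ) ^ 8 := by exact_mod_cast hv100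
    have := hN₁ Z hN₁Z
    nlinarith [h8]
  have hne : 1 * Z ^ 4 ≠ c * Zm * (Z + 1) * t ^ 4 := by rw [heq]; omega
  have key := h (c * Zm * (Z + 1)) 1 t Z hZ₀ hvpos one_pos htpos hcop hmax hne
  have habs : |((1 * Z ^ 4 : ℕ) : ℝ) - ((c * Zm * (Z + 1) * t ^ 4 : ℕ) : ℝ)| = 1 := by
    rw [heq]; push_cast
    rw [show ((c : ℝ) * (Zm : ℝ) * ((Z : ℝ) + 1) * (t : ℝ) ^ 4 + 1 - (c : ℝ) * (Zm : ℝ) * ((Z : ℝ) + 1) * (t : ℝ) ^ 4)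
      = 1 by ring]
    norm_num
  rw [habs] at key
  have hZ1 : (1 : ℝ) ≤ ((Z : ℕ) : ℝ) := by exact_mod_cast le_trans ht1 htZ'
  have : (1 : ℝ) ≤ ((Z : ℕ) : ℝ) ^ φ := Real.one_le_rpow hZ1 hφ
  linarith

/-- **The proved FALSE region of the two-exponent diagram, five corners** (`(8/3, 0)` replacing `(3, 0)`). -/
theorem ubq₂_false_of_corner₅ {θ φ : ℝ}
    (hc : (8 / 3 < θ ∧ 0 ≤ φ) ∨ (2 < θ ∧ 1 < φ) ∨ (1 < θ ∧ 3 / 2 < φ) ∨ (0 < θ ∧ 2 < φ)) :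
    ¬ ∃ Z₀ : ℕ, ∀ v w Y Z : ℕ, Z₀ ≤ Z → 0 < v → 0 < w → 0 < Y → Nat.Coprime (v * Y) (w * Z) →
      ((max v w : ℕ) : ℝ) ≤ (Z : ℝ) ^ θ → w * Z ^ 4 ≠ v * Y ^ 4 →
      (Z : ℝ) ^ φ < |((w * Z ^ 4 : ℕ) : ℝ) - ((v * Y ^ 4 : ℕ) : ℝ)| := by
  rcases hc with ⟨hθ, hφ⟩ | hc
  · exact not_ubq₂_corner_eightThirds_zero θ φ hθ hφ
  · exact ubq₂_false_of_corner hc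

end Summit.ABC.ABC.Theorems.TowerFourSubLiouville.Negative
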